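import Summits.Ventures.QEC.CircuitDistance.PortK2DataBB144Z
import Summits.Ventures.QEC.CircuitDistance.K2Chunks
import HarnessLib

/-!
# K2(`[[144,12,12]]`) chunk module — COMPUTATIONAL (native_decide; `Lean.ofReduceBool`)

Cell `qec`, CDX, R146/R152 STEP 1 («computational» header; `ofReduceBool` confined to these chunk modules). Checker of record
`K2.K2Data` (qec-cdx-type-1, PortK2Check); data module of record `PortK2DataBB144X/Z` (p669158/9, crit-1 data audit PASS
2026-08-28T21:20Z); chunk glue `K2Chunks` (idea-1 g2). Cube 0, child 16: leaf group 3 of 7.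
Leaf theorems: the K2 DFS accepts below one descendant state of pivot cube 0 (sector Z); sizes are exact DFS visit counts
(eng-1 g2 `k2count.c`), capped so that the gate's native-axiom audit re-verifies every leaf in place. Assemblies re-derive the
child lists in the kernel (`decide`) and end in the literal cube fact `d144Z.cube (Ts144Z.getD 0 []) (0) (lives144Z.getD 0 0) = true`
(the `hcubes` hypothesis of `K2Inst.k2_complete`). Emitted by qec-cdx-eng-1 g2 (`gen2.py`, idea-1's `gen_k2chunks_from_lean.py` lineage).
-/

namespace Summit.Ventures.QEC.CircuitDistance.K2

set_option maxRecDepth 100000 in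
set_option maxHeartbeats 0 in
set_option exponentiation.threshold 1024 in
/-- K2(144) chunk fact `cube144Z0_ch16_4` (668243 DFS visits; see the module docstring). -/
theorem cube144Z0_ch16_4 : app5 (d144Z.dfs (Ts144Z.getD 0 []) 6) (148744906084978804736, 3724, 1989292945639146568621528992587283360401824603189390869761856526542657630740270951694337, 3, 2348542582773833227887491303843696043285675130013521948202956262740904142339886023530252872112974815511445468) = true := by native_decide

set_option maxRecDepth 100000 in
set_option maxHeartbeats 0 in
set_option exponentiation.threshold 1024 in
/-- K2(144) chunk fact `cube144Z0_ch16_5` (521361 DFS visits; see the module docstring). -/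
theorem cube144Z0_ch16_5 : app5 (d144Z.dfs (Ts144Z.getD 0 []) 6) (448545100048149512192, 12, 1989292945639146568621528992587283360401824960001314046251826172144130350423917597818881, 3, 2348542582773833227887491303843696043285675130013521948202956262384092219163396053265681379750601031415758812) = true := by native_decide

set_option maxRecDepth 100000 in
set_option maxHeartbeats 0 in
set_option exponentiation.threshold 1024 in
/-- K2(144) chunk fact `cube144Z0_ch16_6` (343846 DFS visits; see the module docstring). -/
theorem cube144Z0_ch16_6 : app5 (d144Z.dfs (Ts144Z.getD 0 []) 6) (2528411483340483330304, 1676, 1989292945639146568621528992587283360401827457684776281681618024144576887040406267625473, 3, 2348542582773833227887491303843696043285675130013521948202956259529596833751476291149109440851610758650265564) = true := by native_decide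

set_option maxRecDepth 100000 in
set_option maxHeartbeats 0 in
set_option exponentiation.threshold 1024 in
/-- K2(144) chunk fact `cube144Z0_ch16_7` (320287 DFS visits; see the module docstring). -/
theorem cube144Z0_ch16_7 : app5 (d144Z.dfs (Ts144Z.getD 0 []) 6) (1331678398608622766080, 3724, 1989292945639146568621528992587283360402007290894057232626631368176727523427590493700097, 3, 2348542582773833227887491303843696043285675130013521948202956076841892167388611515688505351316233301658697692) = true := by native_decide
end Summit.Ventures.QEC.CircuitDistance.K2
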